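import Summits.QuantumFields.YangMills.Theorems.CurvatureKernelBound.Negative.Handles

/-!
# `CurvatureKernelBound` — negative lemmas II: UV scaling is the exact content of the bound

Supports crux item `stmt-QuantumFields-11687` (`PencilRigidity.CurvatureKernelBound`: for every compact simple
`G`, `r`, `sch` and one-species `S₁` carrying the curvature package `W₁`, the two-point function of `S₁` on `⁰𝒮`
is integration against a REAL kernel `K(x₀ − x₁)`, continuous off `0`, with `|K x| ≤ C (1 + ‖x‖^(η−10))`,
`η > 0`). Standing disprover's negative lemmas (refuter, cdisprove); no conclusion below asserts a Theses
statement positively.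

§B **DISPROOF CRITERION.** If `K` represents `T` on `⁰𝒮` with the crux's bound then on the dilates
`F_s = F(·/s)` of a separated off-diagonal `F` (`δ ≤ ‖x₀ − x₁‖ ≤ R` on `supp F`),
`‖T F_s‖ ≤ C s⁸ (1 + s^(η−10) max(δ^(η−10), R^(η−10))) ‖F‖₁` (`norm_two_point_dil_le`), hence
`s_j² ‖T F_{s_j}‖ → 0` along every `s_j → 0⁺` (`tendsto_sq_mul_norm_two_point_dil`): a `W₁`-inhabitant kills the
crux iff its renormalised `tr F²` two-point function is NOT `o(s⁻²)` under `⁰𝒮`-dilations, i.e. has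
"dimension ≥ 5" (`not_representsCLM_of_dilation_blowup`, `not_kernelConclusion_of_dilation_blowup`), and the
crux implies this threshold for every inhabitant (`dimension_threshold_of_curvatureKernelBound`). Tightness:
the power kernels `‖x‖^(η−10)` are kernel data and scale exactly like `s^(η−2)` (`kernelData_rpow`,
`integral_rpow_kernel_dil`; `η = 0` is the forbidden rate `s⁻²`). [folklore]
-/

open scoped BigOperators Topology SchwartzMap
open MeasureTheory Filter Set
open Literature.MathematicalPhysics.QuantumLattice Literature.MathematicalPhysics.AQFT
  Literature.MathematicalPhysics.QuantumFieldTheory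

noncomputable section

namespace Summit.QuantumFields.YangMills.Theorems.CurvatureKernelBound.Negative

/-! ## §B The UV scaling test (dimension-5 threshold) -/

/-- Dilation of two-point test functions: `(dil s hs F) x = F (s⁻¹ • x)`. -/
abbrev dil (s : ℝ) (hs : s ≠ 0) : 𝓢((Fin 2 → E4), ℂ) →L[ℂ] 𝓢((Fin 2 → E4), ℂ) :=
  dilateTest s hs

/-- Pointwise formula for the dilation. [folklore] -/
theorem dil_apply (s : ℝ) (hs : s ≠ 0) (F : 𝓢((Fin 2 → E4), ℂ)) (x : Fin 2 → E4) :
    dil s hs F x = F (s⁻¹ • x) := rfl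



/-- `⁰𝒮` is dilation invariant. -/
theorem isOffDiagonal_dil {s : ℝ} (hs : s ≠ 0) {F : 𝓢((Fin 2 → E4), ℂ)} (hF : IsOffDiagonal F) :
    IsOffDiagonal (dil s hs F) := by
  intro x hx k
  have hL : ((dil s hs F : 𝓢((Fin 2 → E4), ℂ)) : (Fin 2 → E4) → ℂ) =
      (F : (Fin 2 → E4) → ℂ) ∘ (s⁻¹ • ContinuousLinearMap.id ℝ (Fin 2 → E4)) := by
    funext y; simp
  have hx' : (s⁻¹ • ContinuousLinearMap.id ℝ (Fin 2 → E4)) x ∈ coincidenceLocus 2 E4 := by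
    obtain ⟨i, j, hij, hxij⟩ := hx
    exact ⟨i, j, hij, by simp [hxij]⟩
  rw [hL, ContinuousLinearMap.iteratedFDeriv_comp_right _ (F.smooth _) x (i := k) le_rfl,
    hF _ hx' k]
  ext; simp

/-- Change of variables under dilation of the test function. -/
theorem integral_kernel_dil (K : E4 → ℝ) (F : 𝓢((Fin 2 → E4), ℂ)) {s : ℝ} (hs : 0 < s) :
    ∫ x : Fin 2 → E4, (K (x 0 - x 1) : ℂ) * dil s hs.ne' F x =
      (s ^ 8 : ℝ) • ∫ u : Fin 2 → E4, (K (s • (u 0 - u 1)) : ℂ) * F u := by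
  have h := Measure.integral_comp_inv_smul_of_nonneg (volume : Measure (Fin 2 → E4))
    (fun u : Fin 2 → E4 => (K (s • (u 0 - u 1)) : ℂ) * F u) hs.le
  rw [finrank_config] at h
  rw [← h]
  congr 1; funext x
  simp [smul_sub, smul_inv_smul₀ hs.ne']

/-- The constant of a kernel datum is non-negative. -/
theorem KernelData.C_nonneg {K : E4 → ℝ} {C η : ℝ} (h : KernelData K C η) : 0 ≤ C := by
  obtain ⟨-, -, hb⟩ := h
  have hx : (EuclideanSpace.single (0 : Fin 4) (1 : ℝ) : E4) ≠ 0 := by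
    intro h0; have := congrArg (fun v : E4 => v 0) h0; simp at this
  have h1 := hb _ hx
  have hpos : 0 < 1 + ‖(EuclideanSpace.single (0 : Fin 4) (1 : ℝ) : E4)‖ ^ (η - 10) := by positivity
  by_contra hC
  have := mul_neg_of_neg_of_pos (lt_of_not_ge hC) hpos
  linarith [abs_nonneg (K (EuclideanSpace.single (0 : Fin 4) (1 : ℝ)))]

/-- **UV scaling bound.** If `K` represents `S₁ 2` on `⁰𝒮` with the crux's bound, then on the
dilates `F(·/s)` of an off-diagonal `F` whose support has `δ ≤ ‖x₀ - x₁‖ ≤ R`,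
`‖S₁ 2 F_s‖ ≤ C s⁸ (1 + s^(η-10) max(δ^(η-10), R^(η-10))) ‖F‖_{L¹}` for every `s > 0`. -/
theorem norm_two_point_dil_le {T : TwoPointCLM} {K : E4 → ℝ} {C η : ℝ}
    (hrep : RepresentsCLM T K) (hK : KernelData K C η)
    {F : 𝓢((Fin 2 → E4), ℂ)} (hF : IsOffDiagonal F) {δ R : ℝ} (hδ : 0 < δ)
    (hsep : ∀ x, F x ≠ 0 → δ ≤ ‖x 0 - x 1‖ ∧ ‖x 0 - x 1‖ ≤ R) {s : ℝ} (hs : 0 < s) :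
    ‖T (dil s hs.ne' F)‖ ≤
      C * s ^ 8 * (1 + s ^ (η - 10) * max (δ ^ (η - 10)) (R ^ (η - 10))) * ∫ u, ‖F u‖ := by
  set M := max (δ ^ (η - 10)) (R ^ (η - 10)) with hM
  have hC := hK.C_nonneg
  obtain ⟨hη, hcont, hb⟩ := hK
  obtain ⟨-, hSF⟩ := hrep (dil s hs.ne' F) (isOffDiagonal_dil hs.ne' hF)
  rw [hSF, integral_kernel_dil K F hs, norm_smul, Real.norm_of_nonneg (by positivity)]
  have hpt : ∀ u : Fin 2 → E4,
      ‖(K (s • (u 0 - u 1)) : ℂ) * F u‖ ≤ C * (1 + s ^ (η - 10) * M) * ‖F u‖ := by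
    intro u
    by_cases hu : F u = 0
    · simp [hu]
    obtain ⟨h1, h2⟩ := hsep u hu
    have hw : u 0 - u 1 ≠ 0 := by
      intro h0; rw [h0, norm_zero] at h1; linarith
    have hsw : s • (u 0 - u 1) ≠ 0 := smul_ne_zero hs.ne' hw
    have hKb := hb _ hsw
    rw [norm_mul, Complex.norm_real, Real.norm_eq_abs]
    refine mul_le_mul_of_nonneg_right (hKb.trans ?_) (norm_nonneg _)
    rw [norm_smul, Real.norm_of_nonneg hs.le, Real.mul_rpow hs.le (norm_nonneg _)]
    have hwM : ‖u 0 - u 1‖ ^ (η - 10) ≤ M := by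
      rcases le_or_gt 0 (η - 10) with hpos | hneg
      · exact (Real.rpow_le_rpow (norm_nonneg _) h2 hpos).trans (le_max_right _ _)
      · exact (Real.rpow_le_rpow_of_nonpos hδ h1 hneg.le).trans (le_max_left _ _)
    have hsn : 0 ≤ s ^ (η - 10) := Real.rpow_nonneg hs.le _
    gcongr
  have hint : Integrable (fun u : Fin 2 → E4 => C * (1 + s ^ (η - 10) * M) * ‖F u‖) :=
    (F.integrable.norm.const_mul _)
  calc s ^ 8 * ‖∫ u, (K (s • (u 0 - u 1)) : ℂ) * F u‖
      ≤ s ^ 8 * ∫ u, ‖(K (s • (u 0 - u 1)) : ℂ) * F u‖ := by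
        gcongr; exact norm_integral_le_integral_norm _
    _ ≤ s ^ 8 * ∫ u, C * (1 + s ^ (η - 10) * M) * ‖F u‖ :=
        mul_le_mul_of_nonneg_left (integral_mono_of_nonneg
          (Eventually.of_forall fun _ => norm_nonneg _) hint (Eventually.of_forall hpt))
          (by positivity)
    _ = C * s ^ 8 * (1 + s ^ (η - 10) * M) * ∫ u, ‖F u‖ := by
        rw [integral_const_mul]; ring

/-- **Dimension-5 threshold.** Under the conclusion of the crux, `s² ‖S₁ 2 F_s‖ → 0` along every
sequence of scales `s_j → 0⁺`, for every off-diagonal `F` with `δ ≤ ‖x₀ - x₁‖ ≤ R` on its support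
(the two-point function of `tr F²` has "dimension < 5" on `⁰𝒮`-dilations). -/
theorem tendsto_sq_mul_norm_two_point_dil {T : TwoPointCLM} {K : E4 → ℝ} {C η : ℝ}
    (hrep : RepresentsCLM T K) (hK : KernelData K C η)
    {F : 𝓢((Fin 2 → E4), ℂ)} (hF : IsOffDiagonal F) {δ R : ℝ} (hδ : 0 < δ)
    (hsep : ∀ x, F x ≠ 0 → δ ≤ ‖x 0 - x 1‖ ∧ ‖x 0 - x 1‖ ≤ R)
    {s : ℕ → ℝ} (hs : ∀ j, 0 < s j) (hs0 : Tendsto s atTop (𝓝 0)) :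
    Tendsto (fun j => s j ^ 2 * ‖T (dil (s j) (hs j).ne' F)‖) atTop (𝓝 0) := by
  set M := max (δ ^ (η - 10)) (R ^ (η - 10)) with hM
  set I := ∫ u : Fin 2 → E4, ‖F u‖ with hI
  have hη := hK.1
  have hC := hK.C_nonneg
  have hI0 : 0 ≤ I := integral_nonneg fun _ => norm_nonneg _
  have hbound : ∀ j, s j ^ 2 * ‖T (dil (s j) (hs j).ne' F)‖ ≤
      C * I * (s j ^ 10 + s j ^ η * M) := by
    intro j
    have h := norm_two_point_dil_le hrep hK hF hδ hsep (hs j)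
    have hsj := hs j
    have hpow : s j ^ 2 * s j ^ 8 * s j ^ (η - 10) = s j ^ η := by
      rw [← pow_add, ← Real.rpow_natCast, ← Real.rpow_add hsj]
      norm_num
    calc s j ^ 2 * ‖T (dil (s j) (hs j).ne' F)‖
        ≤ s j ^ 2 * (C * s j ^ 8 * (1 + s j ^ (η - 10) * M) * I) := by gcongr
      _ = C * I * (s j ^ 10 + s j ^ 2 * s j ^ 8 * s j ^ (η - 10) * M) := by ring
      _ = C * I * (s j ^ 10 + s j ^ η * M) := by rw [hpow]
  have hlim : Tendsto (fun j => C * I * (s j ^ 10 + s j ^ η * M)) atTop (𝓝 0) := by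
    have h10 : Tendsto (fun j => s j ^ 10) atTop (𝓝 0) := by simpa using hs0.pow 10
    have hη' : Tendsto (fun j => s j ^ η) atTop (𝓝 0) := by
      have := hs0.rpow_const (p := η) (Or.inr hη.le)
      simpa [Real.zero_rpow hη.ne'] using this
    have : Tendsto (fun j => C * I * (s j ^ 10 + s j ^ η * M)) atTop
        (𝓝 (C * I * (0 + 0 * M))) :=
      tendsto_const_nhds.mul (h10.add (hη'.mul tendsto_const_nhds))
    simpa using this
  exact squeeze_zero (fun j => by positivity) hbound hlim

/-- **Disproof criterion (cdisprove).** A one-species family whose two-point function on some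
off-diagonal `F` is NOT `o(s⁻²)` along some sequence of dilations `s_j → 0⁺` violates the
conclusion of the crux: a counterexample to `CurvatureKernelBound` is exactly a `W₁`-inhabitant
whose `tr F²` two-point function has dimension `≥ 5` on `⁰𝒮` (or no kernel at all). -/
theorem not_representsCLM_of_dilation_blowup (T : TwoPointCLM)
    {F : 𝓢((Fin 2 → E4), ℂ)} (hF : IsOffDiagonal F) {δ R : ℝ} (hδ : 0 < δ)
    (hsep : ∀ x, F x ≠ 0 → δ ≤ ‖x 0 - x 1‖ ∧ ‖x 0 - x 1‖ ≤ R)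
    {s : ℕ → ℝ} (hs : ∀ j, 0 < s j) (hs0 : Tendsto s atTop (𝓝 0))
    (hblow : ¬ Tendsto (fun j => s j ^ 2 * ‖T (dil (s j) (hs j).ne' F)‖) atTop (𝓝 0)) :
    ¬ ∃ (K : E4 → ℝ) (C η : ℝ), KernelData K C η ∧ RepresentsCLM T K := by
  rintro ⟨K, C, η, hK, hrep⟩
  exact hblow (tendsto_sq_mul_norm_two_point_dil hrep hK hF hδ hsep hs hs0)

/-- Family version of the disproof criterion. -/
theorem not_kernelConclusion_of_dilation_blowup (S₁ : SchwingerFamily E4)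
    {F : 𝓢((Fin 2 → E4), ℂ)} (hF : IsOffDiagonal F) {δ R : ℝ} (hδ : 0 < δ)
    (hsep : ∀ x, F x ≠ 0 → δ ≤ ‖x 0 - x 1‖ ∧ ‖x 0 - x 1‖ ≤ R)
    {s : ℕ → ℝ} (hs : ∀ j, 0 < s j) (hs0 : Tendsto s atTop (𝓝 0))
    (hblow : ¬ Tendsto (fun j => s j ^ 2 * ‖S₁ 2 (dil (s j) (hs j).ne' F)‖) atTop (𝓝 0)) :
    ¬ KernelConclusion S₁ := by
  rw [kernelConclusion_iff]
  exact not_representsCLM_of_dilation_blowup (S₁ 2) hF hδ hsep hs hs0 hblow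

/-- The crux ⇒ the dimension-5 threshold for every `W₁`-inhabitant. -/
theorem dimension_threshold_of_curvatureKernelBound
    (h : Summit.QuantumFields.YangMills.Theses.PencilRigidity.CurvatureKernelBound)
    (G : Type) [Group G] [TopologicalSpace G] [IsTopologicalGroup G] [CompactSpace G]
    (hG : IsCompactSimpleLieGroup G) :
    letI : MeasurableSpace G := borel G
    haveI : BorelSpace G := ⟨rfl⟩
    ∀ (r : LatticeRep G) (sch : SpeciesScheme (YMSpecies G)) (S₁ : SchwingerFamily E4),
      W1 G r sch S₁ → ∀ (F : 𝓢((Fin 2 → E4), ℂ)), IsOffDiagonal F → ∀ (δ R : ℝ), 0 < δ →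
        (∀ x, F x ≠ 0 → δ ≤ ‖x 0 - x 1‖ ∧ ‖x 0 - x 1‖ ≤ R) →
        ∀ (s : ℕ → ℝ) (hs : ∀ j, 0 < s j), Tendsto s atTop (𝓝 0) →
          Tendsto (fun j => s j ^ 2 * ‖S₁ 2 (dil (s j) (hs j).ne' F)‖) atTop (𝓝 0) := by
  intro r sch S₁ hW F hF δ R hδ hsep s hs hs0
  obtain ⟨K, C, η, hK, hrep⟩ :=
    (kernelConclusion_iff S₁).1 (curvatureKernelBound_iff.1 h G hG r sch S₁ hW)
  exact tendsto_sq_mul_norm_two_point_dil hrep hK hF hδ hsep hs hs0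

/-- **Tightness of the rate.** The power kernels `‖x‖^(η-10)` are kernel data with `C = 1` … -/
theorem kernelData_rpow {η : ℝ} (hη : 0 < η) : KernelData (fun x : E4 => ‖x‖ ^ (η - 10)) 1 η := by
  refine ⟨hη, ?_, fun x hx => ?_⟩
  · exact ContinuousOn.rpow_const continuous_norm.continuousOn
      (fun x hx => Or.inl (norm_ne_zero_iff.2 hx))
  · rw [abs_of_nonneg (Real.rpow_nonneg (norm_nonneg _) _)]
    linarith [Real.rpow_nonneg (norm_nonneg x) (η - 10)]

/-- … and a power kernel `‖x‖^p` scales EXACTLY like `s^(8+p)` under dilation (`p = η - 10`: the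
rate `s^(η-2)` of `norm_two_point_dil_le` is attained; `p = -10`: the forbidden rate `s⁻²`). -/
theorem integral_rpow_kernel_dil (p : ℝ) (F : 𝓢((Fin 2 → E4), ℂ)) {s : ℝ} (hs : 0 < s) :
    ∫ x : Fin 2 → E4, ((‖x 0 - x 1‖ ^ p : ℝ) : ℂ) * dil s hs.ne' F x =
      (s ^ 8 * s ^ p : ℝ) • ∫ u : Fin 2 → E4, ((‖u 0 - u 1‖ ^ p : ℝ) : ℂ) * F u := by
  rw [integral_kernel_dil (fun x : E4 => ‖x‖ ^ p) F hs, mul_smul]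
  congr 1
  rw [← integral_smul]
  congr 1; funext u
  beta_reduce
  rw [norm_smul, Real.norm_of_nonneg hs.le, Real.mul_rpow hs.le (norm_nonneg _),
    Complex.real_smul]
  push_cast
  ring

end Summit.QuantumFields.YangMills.Theorems.CurvatureKernelBound.Negative
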